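import Summits.Ventures.CertifiedManyBodySolver.Theorems.M3x2EdgeSplitSymReplaySideFacts
import HarnessLib

/-!
# SymReplay checker — MFD's two side facts hold for EVERY well-formed certificate (no `native_decide`, no grammar hypothesis)

(landed verbatim by hub-lb-sym-eng-4 g3 on the author's word, STATUS l.2230, with 5 one-line docstrings added; team lb-sym, cell hub-lb; CANDIDATE TEXT by the referee hub-lb-sym-ref-2 g2 for an engine to land — e.g. as
`Theorems/M3x2EdgeSplitSymReplaySideFacts.lean`, `--supports stmt-Ventures-22024 --as helper`; imports the landed `…SideFacts` (p667446) for `colsAscLt_of_pairwise` / `lt_blockWidth` / `denseOKR_of_sorted` and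
SUPERSEDES its grammar route: nothing here depends on how `K.gramR` was decoded, so rung V (grammar v1) is covered too.)

1. **`liftOKR K = true` for EVERY `K : SymCertR`** (`liftOKR_all`): `blockDen B = rowsDen B.rows` is the lcm of all denominators of the
   block's entries, so it is positive (`rowsDen_pos`) and a multiple of every entry's denominator (`den_dvd_rowsDen`); hence
   `q · D` is the integer `q.num · (D / q.den)` and `liftRow D (rowZ D r) = r` (`liftRow_rowZ`).  The β module's `hZ := by native_decide`
   was never a real condition.
2. **`denseOKR K = true` from `hwf : wellFormed K.expand = true`** (`denseOKR_of_wellFormed`): `SymCertR.expand` appends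
   `K.gramR.map toGramBlock` to `gramM`, `toGramBlock` keeps `rows`, and `gramBlockOK`'s third clause is `rows.all rowAsc`
   (`rowsAsc_of_wellFormed`); an ascending row has pairwise-increasing columns (`pairwise_of_rowAsc`), `rowZ` keeps the columns, and
   `blockWidth B` exceeds every column of `B` by definition (`lt_blockWidth`) ⇒ `rowOKZ` (`denseOKR_of_sorted`).
3. **`energyDensity_ge_of_outroutePMFD0'`**: the β⁺ closing `…PMFD0` with `…PMF0`'s binder list EXACTLY — `hZ`, `hD` discharged inside.

HONEST FRAMING: proof plumbing that removes two per-certificate evaluations; certifies nothing; no certificate lands by this file; no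
bound of record moves (#529 −0.8295699476 outside Lean; tree floor −0.8942613047 computational; stmt-Ventures-22024 met BY VALUE only,
un-landed; stmt-Ventures-21721 open); no summit or crux statement is proved here; nothing here predicts superconductivity.
-/

namespace Summit.Ventures.CertifiedManyBodySolver.Theorems.SymReplay

open Literature.MathematicalPhysics.QuantumLattice
open Literature.MathematicalPhysics.QuantumLattice.HubbardWave0
open Literature.MathematicalPhysics.QuantumLattice.ThermodynamicLimit
open Literature.Probability.LatticeModels
open Literature.MathematicalPhysics.QuantumManyBody.StateRelaxation
open Summit.Ventures.CertifiedManyBodySolver.Theorems.WardSlot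

section SideFactsWf

/-! ### 1. `liftOKR` for every certificate -/

/-- The start value divides the `lcm` fold of a row's denominators. -/
theorem dvd_foldl_lcm_den (r : List (ℚ × ℕ)) : ∀ d : ℕ, d ∣ r.foldl (fun d e => Nat.lcm d e.1.den) d := by
  induction r with
  | nil => intro d; exact dvd_rfl
  | cons e r ih => intro d; rw [List.foldl_cons]; exact (Nat.dvd_lcm_left d e.1.den).trans (ih _)

/-- Every entry's denominator divides the `lcm` fold of its row. -/
theorem den_dvd_foldl_lcm_den (r : List (ℚ × ℕ)) :
    ∀ (d : ℕ), ∀ e ∈ r, e.1.den ∣ r.foldl (fun d e => Nat.lcm d e.1.den) d := by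
  induction r with
  | nil => intro d e he; simp at he
  | cons e' r ih =>
    intro d e he
    rw [List.foldl_cons]
    rcases List.mem_cons.1 he with rfl | he
    · exact (Nat.dvd_lcm_right d e.1.den).trans (dvd_foldl_lcm_den r _)
    · exact ih _ e he

/-- The `lcm` fold of denominators stays positive from a positive start. -/
theorem foldl_lcm_den_pos (r : List (ℚ × ℕ)) : ∀ d : ℕ, 0 < d → 0 < r.foldl (fun d e => Nat.lcm d e.1.den) d := by
  induction r with
  | nil => intro d hd; exact hd
  | cons e r ih => intro d hd; rw [List.foldl_cons]; exact ih _ (Nat.lcm_pos hd (Nat.pos_of_ne_zero e.1.den_nz))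

/-- The start value divides the `lcm` fold over all rows. -/
theorem dvd_foldl_rowsDen (rows : List (List (ℚ × ℕ))) :
    ∀ d : ℕ, d ∣ rows.foldl (fun d r => r.foldl (fun d e => Nat.lcm d e.1.den) d) d := by
  induction rows with
  | nil => intro d; exact dvd_rfl
  | cons r rows ih => intro d; rw [List.foldl_cons]; exact (dvd_foldl_lcm_den r d).trans (ih _)

/-- Every entry's denominator divides the block denominator. -/
theorem den_dvd_rowsDen (rows : List (List (ℚ × ℕ))) : ∀ r ∈ rows, ∀ e ∈ r, e.1.den ∣ rowsDen rows := by
  unfold rowsDen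
  suffices hs : ∀ (d : ℕ), ∀ r ∈ rows, ∀ e ∈ r,
      e.1.den ∣ rows.foldl (fun d r => r.foldl (fun d e => Nat.lcm d e.1.den) d) d from hs 1
  induction rows with
  | nil => intro d r hr; simp at hr
  | cons r' rows ih =>
    intro d r hr e he
    rw [List.foldl_cons]
    rcases List.mem_cons.1 hr with rfl | hr
    · exact (den_dvd_foldl_lcm_den r d e he).trans (dvd_foldl_rowsDen rows _)
    · exact ih _ r hr e he

/-- The block denominator is positive. -/
theorem rowsDen_pos (rows : List (List (ℚ × ℕ))) : 0 < rowsDen rows := by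
  unfold rowsDen
  suffices hs : ∀ d : ℕ, 0 < d → 0 < rows.foldl (fun d r => r.foldl (fun d e => Nat.lcm d e.1.den) d) d from
    hs 1 Nat.one_pos
  induction rows with
  | nil => intro d hd; exact hd
  | cons r rows ih => intro d hd; rw [List.foldl_cons]; exact ih _ (foldl_lcm_den_pos r d hd)

/-- Scaling by a common multiple of the denominators and reading numerators is undone by `liftRow`. -/
theorem liftRow_rowZ (D : ℕ) (hD : 0 < D) (r : List (ℚ × ℕ)) (h : ∀ e ∈ r, e.1.den ∣ D) :
    liftRow (D : ℚ) (rowZ D r) = r := by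
  unfold liftRow rowZ
  rw [List.map_map]
  conv_rhs => rw [← List.map_id r]
  refine List.map_congr_left fun e he => ?_
  obtain ⟨k, hk⟩ := h e he
  obtain ⟨q, c⟩ := e
  dsimp only at hk
  have hqD : q * (D : ℚ) = ((q.num * k : ℤ) : ℚ) := by
    rw [hk, Nat.cast_mul, ← mul_assoc, Rat.mul_den_eq_num, Int.cast_mul, Int.cast_natCast]
  have hD' : (D : ℚ) ≠ 0 := by exact_mod_cast hD.ne'
  simp only [Function.comp_apply, id_eq, Prod.mk.injEq, and_true]
  rw [hqD, Rat.num_intCast, ← hqD]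
  exact mul_div_cancel_right₀ q hD'

/-- Every list of rows passes `liftOK` at its own `rowsDen`. -/
theorem liftOK_rowsDen (rows : List (List (ℚ × ℕ))) : liftOK (rowsDen rows) rows = true := by
  unfold liftOK
  simp only [List.all_eq_true, decide_eq_true_eq]
  intro r hr
  exact liftRow_rowZ _ (rowsDen_pos rows) r (den_dvd_rowsDen rows r hr)

/-- **`liftOKR` holds for EVERY R-certificate.** -/
theorem liftOKR_all (K : SymCertR) : liftOKR K = true := by
  unfold liftOKR blockDen
  simp only [List.all_eq_true, Bool.and_eq_true, decide_eq_true_eq]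
  intro B _
  exact ⟨rowsDen_pos B.rows, liftOK_rowsDen B.rows⟩

/-! ### 2. `denseOKR` from `wellFormed K.expand` -/

/-- Rows of every R-block of a certificate whose expansion is well formed are ascending (`gramBlockOK`'s `rows.all rowAsc`
clause, reached through `SymCertR.expand`'s `gramM := K.gramM ++ K.gramR.map toGramBlock`). -/
theorem rowsAsc_of_wellFormed (K : SymCertR) (hwf : wellFormed K.expand = true) :
    ∀ B ∈ K.gramR, ∀ r ∈ B.rows, rowAsc r = true := by
  simp only [wellFormed, SymCertR.expand, Bool.and_eq_true] at hwf
  obtain ⟨⟨⟨⟨⟨⟨⟨⟨⟨⟨⟨⟨⟨_, _⟩, _⟩, _⟩, _⟩, _⟩, hgM⟩, _⟩, _⟩, _⟩, _⟩, _⟩, _⟩, _⟩ := hwf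
  intro B hB r hr
  have h := List.all_eq_true.1 hgM (toGramBlock B) (List.mem_append_right _ (List.mem_map.2 ⟨B, hB, rfl⟩))
  simp only [gramBlockOK, Bool.and_eq_true, decide_eq_true_eq, List.all_eq_true] at h
  exact h.1.2 r hr

/-- The `Bool` form some closings take. -/
theorem hAsc_of_wellFormed (K : SymCertR) (hwf : wellFormed K.expand = true) :
    (K.gramR.all fun B => B.rows.all rowAsc) = true :=
  List.all_eq_true.2 fun B hB => List.all_eq_true.2 fun r hr => rowsAsc_of_wellFormed K hwf B hB r hr

/-- An ascending row has pairwise strictly increasing columns. -/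
theorem pairwise_of_rowAsc : ∀ (r : List (ℚ × ℕ)), rowAsc r = true → r.Pairwise (fun e e' => e.2 < e'.2)
  | [], _ => List.Pairwise.nil
  | (_, _) :: r, h => List.Pairwise.cons (fun e he => rowAsc_lt h e he) (pairwise_of_rowAsc r (rowAsc_tail h))

/-- **`denseOKR` holds for every R-certificate whose expansion is well formed.** -/
theorem denseOKR_of_wellFormed (K : SymCertR) (hwf : wellFormed K.expand = true) : denseOKR K = true :=
  denseOKR_of_sorted K fun B hB r hr => pairwise_of_rowAsc r (rowsAsc_of_wellFormed K hwf B hB r hr)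

/-! ### 3. The β⁺ closing with `…PMF0`'s binder list exactly -/

variable {M : Type} [DecidableEq M] [Hashable M]

/-- **Hierarchical routing, dense integer dots, bare packed facts (`J·L` modules) — NO side facts**: hypotheses = `…PMF0`'s;
`liftOKR`/`denseOKR` are discharged by `liftOKR_all` / `denseOKR_of_wellFormed`. -/
theorem energyDensity_ge_of_outroutePMFD0' (Sm : MomSpec M) (K : SymCertR) (hwf : wellFormed K.expand = true)
    (hRok : K.gramR.all (gramBlockROK K.frame) = true) (oP : PackedNF.PWord → PackedNF.PHint) (hm : MomTable M)
    (κ₂ : Word → ℕ) (J L : ℕ) (hJ : 0 < J) (hL : 0 < L) (lo hi : ℤ × ℤ) (hbox : boxLicence K.frame lo hi = true)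
    (hcov : coverM Sm K (K.gramR.map genBasis) hm = true)
    (hfacts : OutFactsP0 lo hi oP (fun m => shareRFastMFD Sm K (K.gramR.map genBasis) hm κ₂ J L (m / L) (m % L)) 0 (J * L)) :
    ((symValueR K : ℚ) : ℝ) ≤ energyDensityTT' 1 0 8 (7 / 8) :=
  energyDensity_ge_of_outroutePMFD0 Sm K hwf hRok oP hm κ₂ J L hJ hL lo hi hbox hcov (liftOKR_all K)
    (denseOKR_of_wellFormed K hwf) hfacts

end SideFactsWf

end Summit.Ventures.CertifiedManyBodySolver.Theorems.SymReplay
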